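import Mathlib.Analysis.SpecialFunctions.Elliptic.Weierstrass
import HarnessLib

/-!
# The Uniformization Theorem for complex lattices; real (conjugation-stable) lattices

Topic `NumberTheory/EllipticCurves`; first layer of the decomposition of the named fact
`WeierstrassCurve.exists_periodPair_realPeriod_eq` (`Literature/…/RealPeriod.lean`).

For a period pair `L = (ω₁, ω₂)` (Mathlib `PeriodPair`, lattice `Λ = ℤω₁ + ℤω₂ ⊂ ℂ`, invariants
`g₂(Λ) = 60 G₄(Λ)`, `g₃(Λ) = 140 G₆(Λ)`, `PeriodPair.g₂`, `PeriodPair.g₃`) the **Uniformization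
Theorem** (Silverman, AEC, Thm. VI.5.1) says that `Λ ↦ (g₂(Λ), g₃(Λ))` is a bijection from lattices
in `ℂ` onto `{(A, B) ∈ ℂ² | A³ − 27B² ≠ 0}`.  Silverman states it and refers to Apostol, Serre
(*Cours d'arithmétique* VII Prop. 5), Shimura, and his *Advanced Topics* I.4.3 for the proof, which
goes through the surjectivity of the modular invariant `j : ℍ → ℂ`; it is not in Mathlib.  We vendor
the two halves as named facts (D-0014):

* `PeriodPair.uniformization` : existence (AEC VI.5.1, existence half);
* `PeriodPair.uniformization_unique` : uniqueness of the *lattice* (AEC VI.5.1, uniqueness half;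
  the period pair itself is of course only unique up to `SL₂(ℤ)`).

(Silverman's printed hypothesis in the 2nd edition reads `4A³ − 27B² ≠ 0`; with his normalisation
`y² = 4x³ − g₂x − g₃`, `Δ(Λ) = g₂³ − 27g₃²` (AEC VI.3.6, Rem. VI.3.5.1) the correct non-degeneracy
condition is `A³ − 27B² ≠ 0`, which is what we state (the printed form would be false, e.g.
`A = 3, B = 1`); this is the form in Whittaker–Watson §21.73 ("`g₂³ ≠ 27g₃²`") and Serre,
*Cours d'arithmétique*, VII Prop. 5.)

The curve form of the existence half — every elliptic curve `W/ℂ` has a period pair with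
`g₂ = c₄/12`, `g₃ = c₆/216` — is the named fact `Literature.NumberTheory.EllipticCurves.ModularForms.exists_isNeronLatticeOf` of
`Literature/NumberTheory/EllipticCurves/ModularCurve.lean`; it is the special case
`A = c₄/12`, `B = c₆/216` of `PeriodPair.uniformization` since `(c₄/12)³ − 27(c₆/216)² = Δ`
(`WeierstrassCurve.c₄_div_cube_sub` in `RealPeriodProofs.lean`), and should be discharged from it.

This file is a deliberate dot-notation extension of Mathlib's `PeriodPair` namespace.

We also set up the elementary theory of **complex conjugation of lattices**, all proved:

* `PeriodPair.conjugate L` : the period pair `(conj ω₁, conj ω₂)`; `mem_conjugate_lattice`,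
  `G_conjugate`, `g₂_conjugate`, `g₃_conjugate`;
* `PeriodPair.IsReal L` : the lattice is stable under complex conjugation ("real lattice", the
  lattices of elliptic curves defined over `ℝ`) — a predicate on `L`, not a named fact;
  `IsReal.conjugate_lattice_eq`, `IsReal.g₂_im`, `IsReal.g₃_im` (a real lattice has real
  invariants); `isReal_iff` (generators suffice), the rectangular / rhombic criteria
  `isReal_of_conj_ω₁_eq_self_of_conj_ω₂_eq_neg` / `isReal_of_conj_ω₁_eq_ω₂`, `exists_isReal`
  (`ℤ ⊕ ℤi`) and `exists_not_isReal` (`ℤ·4 ⊕ ℤ(1 + 4i)`);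
* `PeriodPair.isReal_of_g₂_g₃_real` : conversely, *assuming* `uniformization_unique`, a lattice
  with real invariants is real (this is how VI.5.1 enters the real-period formula).

## References

* J. H. Silverman, *The Arithmetic of Elliptic Curves*, 2nd ed., GTM 106, Springer 2009,
  Thm. VI.5.1 (p. 173 of the printed book), Cor. VI.5.1.1, and C.12.11.
* E. T. Whittaker, G. N. Watson, *A Course of Modern Analysis*, §21.73 (the inversion problem for
  the Weierstrass elliptic function).
* J.-P. Serre, *A Course in Arithmetic*, VII Prop. 5.
-/

noncomputable section

open scoped ComplexConjugate

namespace PeriodPair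

variable (L : PeriodPair)

/-! ### Named facts: the Uniformization Theorem (Silverman AEC VI.5.1) -/

/-- **Uniformization Theorem, existence** (Silverman, AEC, Thm. VI.5.1): for complex numbers
`A, B` with `A³ − 27B² ≠ 0` there is a lattice `Λ ⊂ ℂ` with `g₂(Λ) = A` and `g₃(Λ) = B`
(here: a Mathlib `PeriodPair` spanning it).  Silverman defers the proof to the theory of modular
functions (surjectivity of `j`, AEC C.12.11 / ATAEC I.4.3).  NB: the 2nd edition prints the
hypothesis as `4A³ − 27B² ≠ 0`; the correct condition for `y² = 4x³ − Ax − B` to be nonsingular,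
stated here, is `A³ − 27B² ≠ 0` (Whittaker–Watson §21.73, Serre VII Prop. 5; see the module doc).
[cite: SilvermanAEC2009, Thm VI.5.1 (existence)] -/
def uniformization : Prop :=
  ∀ A B : ℂ, A ^ 3 - 27 * B ^ 2 ≠ 0 → ∃ L : PeriodPair, L.g₂ = A ∧ L.g₃ = B

/-- **Uniformization Theorem, uniqueness** (Silverman, AEC, Thm. VI.5.1): a lattice `Λ ⊂ ℂ` is
determined by its invariants `g₂(Λ)`, `g₃(Λ)` (two period pairs with the same invariants span the
same lattice).  Classical proof: the Laurent coefficients of `℘_Λ` at `0` are polynomials in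
`g₂, g₃`, so `℘_Λ = ℘_{Λ'}`, and `Λ` is the set of poles of `℘_Λ`.
[cite: SilvermanAEC2009, Thm VI.5.1 (uniqueness)] -/
def uniformization_unique : Prop :=
  ∀ L L' : PeriodPair, L.g₂ = L'.g₂ → L.g₃ = L'.g₃ → L.lattice = L'.lattice

/-! ### Complex conjugation of a period pair (proved API) -/

/-- The complex-conjugate period pair `(conj ω₁, conj ω₂)`; its lattice is the complex conjugate
of `L.lattice` (`mem_conjugate_lattice`).  (Silverman, ATAEC, §V.2; Lawden, *Elliptic Functions and
Applications*, §6.15 "conjugate primitive periods".) [folklore] -/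
def conjugate : PeriodPair where
  ω₁ := conj L.ω₁
  ω₂ := conj L.ω₂
  indep := by
    have h := L.indep.map' (Complex.conjAe.toLinearEquiv : ℂ ≃ₗ[ℝ] ℂ).toLinearMap
      (LinearEquiv.ker _)
    have e : ⇑(Complex.conjAe.toLinearEquiv : ℂ ≃ₗ[ℝ] ℂ).toLinearMap ∘ ![L.ω₁, L.ω₂] =
        ![conj L.ω₁, conj L.ω₂] := by
      ext i
      fin_cases i <;> simp
    rwa [e] at h

/-- First period of the conjugate pair. [folklore] -/
@[simp] lemma conjugate_ω₁ : L.conjugate.ω₁ = conj L.ω₁ := rfl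

/-- Second period of the conjugate pair. [folklore] -/
@[simp] lemma conjugate_ω₂ : L.conjugate.ω₂ = conj L.ω₂ := rfl

/-- `x` lies in the conjugate lattice iff `conj x` lies in the lattice. [folklore] -/
lemma mem_conjugate_lattice {L : PeriodPair} {x : ℂ} :
    x ∈ L.conjugate.lattice ↔ conj x ∈ L.lattice := by
  simp only [mem_lattice, conjugate_ω₁, conjugate_ω₂]
  constructor
  · rintro ⟨m, n, h⟩
    exact ⟨m, n, by rw [← h]; simp⟩
  · rintro ⟨m, n, h⟩
    refine ⟨m, n, ?_⟩
    rw [← Complex.conj_conj x, ← h]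
    simp

/-- `conj x` lies in the conjugate lattice iff `x` lies in the lattice. [folklore] -/
lemma conj_mem_conj_lattice {L : PeriodPair} {x : ℂ} :
    conj x ∈ L.conjugate.lattice ↔ x ∈ L.lattice := by
  rw [mem_conjugate_lattice, Complex.conj_conj]

/-- Conjugation of period pairs is an involution. [folklore] -/
@[simp] lemma conjugate_conjugate : L.conjugate.conjugate = L := by
  cases L with
  | mk a b h => simp only [conjugate, Complex.conj_conj]

/-- Complex conjugation as a bijection `L.lattice ≃ L.conjugate.lattice`. [folklore] -/
def latticeConjEquiv : L.lattice ≃ L.conjugate.lattice where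
  toFun l := ⟨conj (l : ℂ), conj_mem_conj_lattice.mpr l.2⟩
  invFun l := ⟨conj (l : ℂ), by simpa using (mem_conjugate_lattice.mp l.2)⟩
  left_inv l := by ext; simp
  right_inv l := by ext; simp

/-- `latticeConjEquiv` acts as complex conjugation. [folklore] -/
@[simp] lemma coe_latticeConjEquiv (l : L.lattice) : (L.latticeConjEquiv l : ℂ) = conj (l : ℂ) :=
  rfl

/-- Eisenstein series of the conjugate lattice: `G_k(conj Λ) = conj (G_k(Λ))`. [folklore] -/
lemma G_conjugate (n : ℕ) : L.conjugate.G n = conj (L.G n) := by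
  simp only [G, Complex.conj_tsum]
  rw [← L.latticeConjEquiv.tsum_eq]
  congr with l
  simp [map_inv₀, map_pow]

/-- `g₂(conj Λ) = conj g₂(Λ)`. [folklore] -/
lemma g₂_conjugate : L.conjugate.g₂ = conj L.g₂ := by
  simp [g₂, G_conjugate, map_mul, map_ofNat]

/-- `g₃(conj Λ) = conj g₃(Λ)`. [folklore] -/
lemma g₃_conjugate : L.conjugate.g₃ = conj L.g₃ := by
  simp [g₃, G_conjugate, map_mul, map_ofNat]

/-! ### Real lattices -/

/-- A period pair spans a **real lattice** if its lattice is stable under complex conjugation.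
These are exactly the period lattices of elliptic curves defined over `ℝ`; such a lattice is either
*rectangular* (`ℤa ⊕ ℤbi`) or *rhombic* (`ℤa ⊕ ℤ(a/2 + bi)`), `a, b > 0`.
(Silverman, ATAEC, §V.2; Lawden, *Elliptic Functions and Applications*, §§6.11, 6.15.)

This is a DEFINITION — the predicate `PeriodPair.IsReal : PeriodPair → Prop` — not a named fact:
there is nothing to discharge (it holds for `ℤ ⊕ ℤi`, `exists_isReal`, and fails for
`ℤ·4 ⊕ ℤ(1 + 4i)`, `exists_not_isReal`).  The binder `(L : PeriodPair)` is written explicitly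
(rather than taken from the section `variable`) so that the literature-debt census reads it as the
parametrised predicate it is; the elaborated declaration is unchanged.  Generators suffice:
`isReal_iff`. [folklore] -/
def IsReal (L : PeriodPair) : Prop :=
  ∀ z ∈ L.lattice, conj z ∈ L.lattice

variable {L}

/-- A real lattice equals its conjugate lattice. [folklore] -/
lemma IsReal.conjugate_lattice_eq (h : L.IsReal) : L.conjugate.lattice = L.lattice := by
  ext x
  rw [mem_conjugate_lattice]
  refine ⟨fun hx ↦ ?_, fun hx ↦ h x hx⟩
  simpa using h _ hx

/-- The Eisenstein series only depend on the lattice, not on the chosen basis. [folklore] -/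
lemma G_eq_of_lattice_eq {L L' : PeriodPair} (h : L.lattice = L'.lattice) (n : ℕ) :
    L.G n = L'.G n := by
  simp only [G]
  exact (Equiv.subtypeEquivProp congr(($h : Set ℂ))).tsum_eq fun l : L'.lattice ↦ ((l : ℂ) ^ n)⁻¹

/-- `g₂` only depends on the lattice. [folklore] -/
lemma g₂_eq_of_lattice_eq {L L' : PeriodPair} (h : L.lattice = L'.lattice) : L.g₂ = L'.g₂ := by
  simp [g₂, G_eq_of_lattice_eq h]

/-- `g₃` only depends on the lattice. [folklore] -/
lemma g₃_eq_of_lattice_eq {L L' : PeriodPair} (h : L.lattice = L'.lattice) : L.g₃ = L'.g₃ := by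
  simp [g₃, G_eq_of_lattice_eq h]

/-- A real lattice has real Eisenstein series. [folklore] -/
lemma IsReal.conj_G (h : L.IsReal) (n : ℕ) : conj (L.G n) = L.G n := by
  rw [← G_conjugate, G_eq_of_lattice_eq h.conjugate_lattice_eq]

/-- A real lattice has real `g₂` (Lawden §6.16; Silverman ATAEC §V.2). [folklore] -/
lemma IsReal.g₂_im (h : L.IsReal) : L.g₂.im = 0 := by
  have := h.conj_G 4
  rw [Complex.conj_eq_iff_im] at this
  simp [g₂, this]

/-- A real lattice has real `g₃` (Lawden §6.16; Silverman ATAEC §V.2). [folklore] -/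
lemma IsReal.g₃_im (h : L.IsReal) : L.g₃.im = 0 := by
  have := h.conj_G 6
  rw [Complex.conj_eq_iff_im] at this
  simp [g₃, this]

/-- A real lattice has real `g₂`: `↑(re g₂) = g₂`. [folklore] -/
lemma IsReal.ofReal_g₂_re (h : L.IsReal) : ((L.g₂.re : ℝ) : ℂ) = L.g₂ :=
  Complex.ext (by simp) (by simp [h.g₂_im])

/-- A real lattice has real `g₃`: `↑(re g₃) = g₃`. [folklore] -/
lemma IsReal.ofReal_g₃_re (h : L.IsReal) : ((L.g₃.re : ℝ) : ℂ) = L.g₃ :=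
  Complex.ext (by simp) (by simp [h.g₃_im])

/-- Converse, from the uniqueness half of the Uniformization Theorem: a lattice with real
invariants `g₂, g₃` is stable under complex conjugation (its conjugate has the same invariants).
(Silverman AEC VI.5.1 ⇒ ATAEC §V.2.) [folklore] -/
theorem isReal_of_g₂_g₃_real (hU : uniformization_unique) {L : PeriodPair}
    (h₂ : L.g₂.im = 0) (h₃ : L.g₃.im = 0) : L.IsReal := by
  have h : L.conjugate.lattice = L.lattice := by
    refine hU L.conjugate L ?_ ?_
    · rw [g₂_conjugate]; exact Complex.conj_eq_iff_im.mpr h₂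
    · rw [g₃_conjugate]; exact Complex.conj_eq_iff_im.mpr h₃
  intro z hz
  have : conj z ∈ L.conjugate.lattice := conj_mem_conj_lattice.mpr hz
  rwa [h] at this

/-! ### Real lattices: criteria on the generators, the two shapes, an example and a non-example

`IsReal` is a genuine predicate: it is decided on the two generators (`isReal_iff`), it holds for
rectangular (`conj ω₁ = ω₁`, `conj ω₂ = -ω₂`) and rhombic (`conj ω₁ = ω₂`) pairs — the two shapes of
Silverman ATAEC §V.2 / Lawden §§6.11, 6.15 — e.g. for the Gaussian lattice `ℤ ⊕ ℤi`
(`exists_isReal`), and it fails for `ℤ·4 ⊕ ℤ(1 + 4i)` (`exists_not_isReal`). -/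

/-- A lattice `Λ = ℤω₁ ⊕ ℤω₂` is real as soon as `conj ω₁ ∈ Λ` and `conj ω₂ ∈ Λ` (conjugation is
additive). [folklore] -/
theorem IsReal.of_conj_ω_mem (h₁ : conj L.ω₁ ∈ L.lattice) (h₂ : conj L.ω₂ ∈ L.lattice) :
    L.IsReal := by
  intro z hz
  obtain ⟨m, n, rfl⟩ := mem_lattice.mp hz
  rw [map_add, map_mul, map_mul, map_intCast, map_intCast, ← zsmul_eq_mul, ← zsmul_eq_mul]
  exact add_mem (L.lattice.smul_mem m h₁) (L.lattice.smul_mem n h₂)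

/-- `Λ = ℤω₁ ⊕ ℤω₂` is real iff `conj ω₁ ∈ Λ` and `conj ω₂ ∈ Λ`. [folklore] -/
theorem isReal_iff : L.IsReal ↔ conj L.ω₁ ∈ L.lattice ∧ conj L.ω₂ ∈ L.lattice :=
  ⟨fun h ↦ ⟨h _ L.ω₁_mem_lattice, h _ L.ω₂_mem_lattice⟩, fun h ↦ IsReal.of_conj_ω_mem h.1 h.2⟩

/-- The conjugate lattice `conj Λ` is real iff `Λ` is. [folklore] -/
theorem conjugate_isReal_iff : L.conjugate.IsReal ↔ L.IsReal := by
  constructor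
  · intro h z hz
    have hz' := h (conj z) (conj_mem_conj_lattice.mpr hz)
    rw [Complex.conj_conj] at hz'
    exact mem_conjugate_lattice.mp hz'
  · intro h z hz
    have hz' := h (conj z) (mem_conjugate_lattice.mp hz)
    rw [Complex.conj_conj] at hz'
    exact conj_mem_conj_lattice.mpr hz'

/-- **Rectangular** real lattices (Lawden §6.11): if `ω₁` is real and `ω₂` is purely imaginary
then `Λ` is real. [folklore] -/
theorem isReal_of_conj_ω₁_eq_self_of_conj_ω₂_eq_neg (h₁ : conj L.ω₁ = L.ω₁)
    (h₂ : conj L.ω₂ = -L.ω₂) : L.IsReal := by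
  refine IsReal.of_conj_ω_mem ?_ ?_
  · rw [h₁]; exact L.ω₁_mem_lattice
  · rw [h₂]; exact neg_mem L.ω₂_mem_lattice

/-- **Rhombic** real lattices (Lawden §6.15, conjugate primitive periods): if `conj ω₁ = ω₂` then
`Λ` is real. [folklore] -/
theorem isReal_of_conj_ω₁_eq_ω₂ (h : conj L.ω₁ = L.ω₂) : L.IsReal := by
  refine IsReal.of_conj_ω_mem ?_ ?_
  · rw [h]; exact L.ω₂_mem_lattice
  · rw [← h, Complex.conj_conj]; exact L.ω₁_mem_lattice

/-- Real lattices exist: the Gaussian lattice `ℤ ⊕ ℤi` (period pair `(1, i)`, rectangular) is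
real. [folklore] -/
theorem exists_isReal : ∃ L : PeriodPair, L.IsReal := by
  refine ⟨⟨1, Complex.I, ?_⟩, ?_⟩
  · rw [← Complex.coe_basisOneI]
    exact Complex.basisOneI.linearIndependent
  · exact isReal_of_conj_ω₁_eq_self_of_conj_ω₂_eq_neg (map_one _) Complex.conj_I

/-- Not every lattice is real: `Λ = ℤ·4 ⊕ ℤ(1 + 4i)` is not, since
`conj (1 + 4i) = 1 - 4i = 4m + n(1 + 4i)` forces `n = -1` and `4m = 2`.  (So the predicate
`IsReal` is not a statement with a proof; it is a hypothesis on `Λ`.) [folklore] -/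
theorem exists_not_isReal : ∃ L : PeriodPair, ¬ L.IsReal := by
  refine ⟨⟨4, 1 + 4 * Complex.I, ?_⟩, fun h ↦ ?_⟩
  · refine LinearIndependent.pair_iff.mpr fun s t hst ↦ ?_
    have hre := congrArg Complex.re hst
    have him := congrArg Complex.im hst
    simp only [Complex.real_smul, Complex.add_re, Complex.mul_re, Complex.ofReal_re,
      Complex.ofReal_im, Complex.re_ofNat, Complex.im_ofNat, Complex.one_re, Complex.one_im,
      Complex.I_re, Complex.I_im, Complex.add_im, Complex.mul_im, Complex.zero_re,
      Complex.zero_im] at hre him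
    constructor <;> nlinarith [hre, him]
  · obtain ⟨m, n, hmn⟩ := mem_lattice.mp (h _ (ω₂_mem_lattice _))
    have hre := congrArg Complex.re hmn
    have him := congrArg Complex.im hmn
    simp only [map_add, map_one, map_mul, map_ofNat, Complex.conj_I, Complex.add_re,
      Complex.mul_re, Complex.intCast_re, Complex.intCast_im, Complex.re_ofNat, Complex.im_ofNat,
      Complex.one_re, Complex.one_im, Complex.I_re, Complex.I_im, Complex.add_im, Complex.mul_im,
      Complex.neg_re, Complex.neg_im] at hre him
    have hre' : (m : ℝ) * 4 + n = 1 := by linarith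
    have him' : (n : ℝ) * 4 = -4 := by linarith
    have h1 : (m * 4 + n : ℤ) = 1 := by exact_mod_cast hre'
    have h2 : (n * 4 : ℤ) = -4 := by exact_mod_cast him'
    omega

end PeriodPair

end
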